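import Literature.IUT.HodgeTheaters.TemperedCoveringsCor23iiiProofs
import Literature.IUT.HodgeTheaters.TemperedCoveringsCenterFree
import HarnessLib

/-!
# [IUTchI] Cor. 2.3 (iii): tightness of the "In particular" kernel (kurims p. 47), PROOFS — thin complement

Mochizuki, *Inter-universal Teichmüller theory I: construction of Hodge theaters*, kurims
manuscript (May 2020), §2, Cor. 2.3 (iii) p. 47 [cite: Mochizuki2012, Cor 2.3(iii) p.47] (D-0012 claim
key; series status DISPUTED).  PROOF-ONLY, no definitions, nothing printed is asserted outright.

v2 (2026-08-25): this module is now a THIN COMPLEMENT of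
`Literature.IUT.HodgeTheaters.TemperedCoveringsCor23iiiProofs` (abc-iut-w4-d058, the holder of DAG node
`IUTchI:Cor2.3(iii)` by first claim stamp), which carries the kernel of record
`StableCurveTemperedData.cor23iii_of_slim` (the typed `Cor23iii D` from Cor. 2.3 (i), (ii), the slimness
of `Δ̂_{X,ℍ}`, the centre-freeness of `G_k` and the descent of the outer `G_k`-action).  v1 of this file
(same seat, filed in a claim race) duplicated that kernel under identical names; every duplicated
declaration is REMOVED here so that the two modules can be imported together.  What remains is the part
the kernel of record does not contain — the CONVERSES, i.e. the tightness of its hypotheses: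

* `surjective_normalizer_iff_conj_stable` — for a surjection `pr : P ↠ G` and `M ⊆ P`: `N_P(M) ↠ G` iff
  every `g ∈ P` carries `M` to a `Ker(pr)`-conjugate of `M` (the group-theoretic content of the
  "In particular" of Cor. 2.3 (i), "the natural outer actions of `G_k` … determine natural outer actions
  of `G_k` on `Δ_{X,ℍ}`", as used in (iii) with `Π_{X,ℍ}` "defined so as to render the sequences exact");
* `StableCurveTemperedData.surjective_piTpXH_iff`, `….surjective_piHatXH_iff` — the two instances;
* `StableCurveTemperedData.cor23iii_iff_slim_and_stable` — given Cor. 2.3 (i), (ii) and `Z(G_k) = 1`,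
  under hypothesis (a)/(b) of (iii) the typed `Cor23iii D` is EQUIVALENT to "`Δ̂_{X,ℍ}` is slim and the
  outer `G_k`-actions descend to `Δ^tp_{X,ℍ}`, `Δ̂_{X,ℍ}`": the residual hypotheses of the kernel of
  record are exactly the content of the node beyond (i)/(ii) — nothing was assumed away.

v3 adds, on top of abc-iut-w4-d060's `TemperedCoveringsCenterFree` (Cor. 2.3 (ii) transports the
tempered surjectivity to the profinite one, `prHat_piHatXH_surjective`):
* `StableCurveTemperedData.outerHat_of_outerTp` — the PROFINITE descent hypothesis FOLLOWS from the
  tempered one and Cor. 2.3 (ii) (so the interface atom `outerHat_of_graphStable` of the kernel of record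
  is redundant);
* `StableCurveTemperedData.cor23iii_iff_slim_and_outerTp` — the sharp form of the tightness statement:
  given (i), (ii), `Z(G_k) = 1`, under (a)/(b), `Cor23iii D ⟺ (Δ̂_{X,ℍ} slim ∧ tempered descent)`.

The slimness of `Δ̂_{X,ℍ}` (print pp. 48–49) is proved in none of these files (AFTER-MERGE input, named
hypothesis; abc-iut-w4-d070's `TemperedCoveringsSlimness*` reduces it to per-level inputs).  typed ≠
proved; no side taken on [IUTchIII] Cor. 3.12.
-/

namespace Literature.IUT.HodgeTheaters

open Pointwise
open Literature.AlgebraicGeometry.Frobenioids (IsSlimGroup)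

universe u

/-! ### Group theory: surjectivity of a normaliser onto the quotient ⟺ conjugacy-stability -/

section GroupTheory

variable {P : Type*} [Group P] {G : Type*} [Group G]

/-- `Inn(n) · M = M` for `n` in the normaliser of `M`. [folklore] -/
private theorem conj_smul_eq_self_of_mem_normalizer' {M : Subgroup P} {n : P}
    (hn : n ∈ Subgroup.normalizer (M : Set P)) : MulAut.conj n • M = M := by
  ext x
  rw [Subgroup.mem_pointwise_smul_iff_inv_smul_mem, MulAut.smul_def, MulAut.conj_inv_apply]
  exact (Subgroup.mem_normalizer_iff''.mp hn x).symm

/-- `g · M · g⁻¹ = d · M · d⁻¹` when `d⁻¹ g` normalises `M`. [folklore] -/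
private theorem conj_smul_eq_conj_smul_of_mem_normalizer (M : Subgroup P) {g d : P}
    (h : d⁻¹ * g ∈ Subgroup.normalizer (M : Set P)) : MulAut.conj g • M = MulAut.conj d • M := by
  have := conj_smul_eq_self_of_mem_normalizer' h
  rw [map_mul, mul_smul] at this
  calc MulAut.conj g • M = MulAut.conj d • (MulAut.conj d⁻¹ • (MulAut.conj g • M)) := by
        rw [← mul_smul, ← map_mul, mul_inv_cancel, map_one, one_smul]
    _ = MulAut.conj d • M := by rw [this]

/-- **Surjectivity of `N_P(M) → G` ⟺ stability of the `Ker`-conjugacy class of `M`.**  For a surjection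
`pr : P ↠ G` and a subgroup `M ⊆ P`: the normaliser `N_P(M)` surjects onto `G` iff every `g ∈ P` carries
`M` to a `Ker(pr)`-conjugate of `M` — i.e. iff the outer action of `G = P/Ker(pr)` on `Ker(pr)` preserves
the `Ker(pr)`-conjugacy class of `M`.  (⇐) is abc-iut-w4-d058's `surjective_normalizer_of_outer`; (⇒):
for `g ∈ P` pick `n ∈ N_P(M)` over `pr g`, then `d := g n⁻¹ ∈ Ker(pr)` and `g M g⁻¹ = d M d⁻¹`.
[cite: Mochizuki2012, Cor 2.3(i) p.47] -/
theorem surjective_normalizer_iff_conj_stable (pr : P →* G) (hpr : Function.Surjective pr)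
    (M : Subgroup P) :
    Function.Surjective (pr.comp (Subgroup.normalizer (M : Set P)).subtype) ↔
      ∀ g : P, ∃ d ∈ pr.ker, MulAut.conj g • M = MulAut.conj d • M := by
  refine ⟨fun hs g => ?_, surjective_normalizer_of_outer pr hpr M⟩
  obtain ⟨⟨n, hn⟩, hng⟩ := hs (pr g)
  rw [MonoidHom.comp_apply, Subgroup.subtype_apply] at hng
  refine ⟨g * n⁻¹, by rw [MonoidHom.mem_ker, map_mul, map_inv, hng, mul_inv_cancel], ?_⟩
  apply conj_smul_eq_conj_smul_of_mem_normalizer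
  rw [mul_inv_rev, inv_inv, inv_mul_cancel_right]
  exact hn

end GroupTheory

/-! ### [IUTchI] Cor. 2.3 (iii) for the data `D`: the converses -/

namespace StableCurveTemperedData

variable (D : StableCurveTemperedData.{u})

/-- **Cor. 2.3 (iii), surjectivity `Π^tp_{X,ℍ} ↠ G_k` ⟺ descent of the outer action (tempered).**  The
normaliser `Π^tp_{X,ℍ}` of `Δ^tp_{X,ℍ}` in `Π^tp_X` surjects onto `G_k` iff conjugation by every element of
`Π^tp_X` carries `Δ^tp_{X,ℍ}` to a `Δ^tp_X`-conjugate of itself (the hypothesis `hOutTp` of the kernel of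
record `cor23iii_of_slim`). [cite: Mochizuki2012, Cor 2.3(iii) p.47] -/
theorem surjective_piTpXH_iff :
    Function.Surjective (D.prTp.comp D.piTpXH.subtype) ↔
      ∀ g : D.PiTp, ∃ d : D.DeltaTp, MulAut.conj g • (D.deltaTpH.map D.DeltaTp.subtype) =
        MulAut.conj (d : D.PiTp) • (D.deltaTpH.map D.DeltaTp.subtype) := by
  refine (surjective_normalizer_iff_conj_stable D.prTp D.prTp_surjective _).trans
    ⟨fun h g => ?_, fun h g => ?_⟩
  · obtain ⟨d, hd, h⟩ := h g
    exact ⟨⟨d, hd⟩, h⟩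
  · obtain ⟨d, h⟩ := h g
    exact ⟨d, d.2, h⟩

/-- **Cor. 2.3 (iii), surjectivity `Π̂_{X,ℍ} ↠ G_k` ⟺ descent of the outer action (profinite).**
[cite: Mochizuki2012, Cor 2.3(iii) p.47] -/
theorem surjective_piHatXH_iff :
    Function.Surjective (D.prHat.comp D.piHatXH.subtype) ↔
      ∀ γ : D.PiHat, ∃ d : D.DeltaHat, MulAut.conj γ • (D.deltaHatH.map D.DeltaHat.subtype) =
        MulAut.conj (d : D.PiHat) • (D.deltaHatH.map D.DeltaHat.subtype) := by
  refine (surjective_normalizer_iff_conj_stable D.prHat D.prHat_surjective _).trans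
    ⟨fun h g => ?_, fun h g => ?_⟩
  · obtain ⟨d, hd, h⟩ := h g
    exact ⟨⟨d, hd⟩, h⟩
  · obtain ⟨d, h⟩ := h g
    exact ⟨d, d.2, h⟩

/-- **Tightness of the Cor. 2.3 (iii) kernel.**  Given Cor. 2.3 (i) and (ii) for `D` and `Z(G_k) = 1`
([AbsAnab] Thm. 1.1.1 (ii)), under hypothesis (a)/(b) of (iii) the typed `Cor23iii D` is EQUIVALENT to:
`Δ̂_{X,ℍ}` is slim, and the outer `G_k`-actions descend to `Δ^tp_{X,ℍ}` and to `Δ̂_{X,ℍ}` (the hypotheses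
`hslim`, `hOutTp`, `hOutHat` of abc-iut-w4-d058's `cor23iii_of_slim`).  So the kernel of record assumes
nothing beyond the content of the node. [cite: Mochizuki2012, Cor 2.3(iii) p.47] -/
theorem cor23iii_iff_slim_and_stable [T2Space D.PiHat] (hi : D.Cor23i) (hii : D.Cor23ii)
    (hGk : Subgroup.center D.Gk = ⊥) (hyp : D.Cor23Hyp) :
    Literature.IUT.HodgeTheaters.StableCurveTemperedData.Cor23iii D ↔
      IsSlimGroup D.deltaHatH ∧
        (∀ g : D.PiTp, ∃ d : D.DeltaTp, MulAut.conj g • (D.deltaTpH.map D.DeltaTp.subtype) =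
          MulAut.conj (d : D.PiTp) • (D.deltaTpH.map D.DeltaTp.subtype)) ∧
        ∀ γ : D.PiHat, ∃ d : D.DeltaHat, MulAut.conj γ • (D.deltaHatH.map D.DeltaHat.subtype) =
          MulAut.conj (d : D.PiHat) • (D.deltaHatH.map D.DeltaHat.subtype) := by
  constructor
  · intro h
    exact ⟨h.slim hyp, D.surjective_piTpXH_iff.mp (h.exact_tp hyp).2,
      D.surjective_piHatXH_iff.mp (h.exact_hat hyp).2⟩
  · rintro ⟨hslim, hOutTp, hOutHat⟩
    exact D.cor23iii_of_slim hi hii (fun _ => hslim) hGk hOutTp hOutHat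

/-- **The surjectivity clauses of the typed `Cor23iii` DETERMINE the descent hypotheses** — the
direction the kernel of record does not state: from `Cor23iii D` (under (a)/(b)) the outer
`G_k`-actions descend to `Δ^tp_{X,ℍ}` and `Δ̂_{X,ℍ}`. [cite: Mochizuki2012, Cor 2.3(iii) p.47] -/
theorem outer_of_cor23iii (h : Literature.IUT.HodgeTheaters.StableCurveTemperedData.Cor23iii D)
    (hyp : D.Cor23Hyp) :
    (∀ g : D.PiTp, ∃ d : D.DeltaTp, MulAut.conj g • (D.deltaTpH.map D.DeltaTp.subtype) =
        MulAut.conj (d : D.PiTp) • (D.deltaTpH.map D.DeltaTp.subtype)) ∧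
      ∀ γ : D.PiHat, ∃ d : D.DeltaHat, MulAut.conj γ • (D.deltaHatH.map D.DeltaHat.subtype) =
        MulAut.conj (d : D.PiHat) • (D.deltaHatH.map D.DeltaHat.subtype) :=
  ⟨D.surjective_piTpXH_iff.mp (h.exact_tp hyp).2, D.surjective_piHatXH_iff.mp (h.exact_hat hyp).2⟩

/-- **The profinite descent follows from the tempered descent and Cor. 2.3 (ii).**  If every
`g Δ^tp_{X,ℍ} g⁻¹` (`g ∈ Π^tp_X`) is a `Δ^tp_X`-conjugate of `Δ^tp_{X,ℍ}`, then every `γ Δ̂_{X,ℍ} γ⁻¹`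
(`γ ∈ Π̂_X`) is a `Δ̂_X`-conjugate of `Δ̂_{X,ℍ}`: the tempered descent gives `Π^tp_{X,ℍ} ↠ G_k`
(abc-iut-w4-d058), Cor. 2.3 (ii) transports it to `Π̂_{X,ℍ} ↠ G_k` (abc-iut-w4-d060's
`prHat_piHatXH_surjective`), and surjectivity of the normaliser is EQUIVALENT to descent
(`surjective_piHatXH_iff`).  Hence the hypothesis `hOutHat` of the kernel of record is implied by
`hOutTp` + (ii). [cite: Mochizuki2012, Cor 2.3(iii) p.47] -/
theorem outerHat_of_outerTp (hii : D.Cor23ii)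
    (hOutTp : ∀ g : D.PiTp, ∃ d : D.DeltaTp, MulAut.conj g • (D.deltaTpH.map D.DeltaTp.subtype) =
      MulAut.conj (d : D.PiTp) • (D.deltaTpH.map D.DeltaTp.subtype)) :
    ∀ γ : D.PiHat, ∃ d : D.DeltaHat, MulAut.conj γ • (D.deltaHatH.map D.DeltaHat.subtype) =
      MulAut.conj (d : D.PiHat) • (D.deltaHatH.map D.DeltaHat.subtype) :=
  D.surjective_piHatXH_iff.mp
    (D.prHat_piHatXH_surjective hii (D.piTpXH_surjective_of_outer hOutTp))

/-- **Sharp tightness of the Cor. 2.3 (iii) kernel.**  Given Cor. 2.3 (i), (ii) for `D` and `Z(G_k) = 1`,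
under hypothesis (a)/(b) of (iii) the typed `Cor23iii D` is EQUIVALENT to: `Δ̂_{X,ℍ}` is slim and the
outer `G_k`-action descends to `Δ^tp_{X,ℍ}` (tempered side only) — i.e. exactly the hypotheses of
abc-iut-w4-d060's `cor23iii_of_slim_of_stable` / `cor23iii_of_slim_of_surjective` (up to the shape of the
stability binder, `surjective_piTpXH_iff`). [cite: Mochizuki2012, Cor 2.3(iii) p.47] -/
theorem cor23iii_iff_slim_and_outerTp [T2Space D.PiHat] (hi : D.Cor23i) (hii : D.Cor23ii)
    (hGk : Subgroup.center D.Gk = ⊥) (hyp : D.Cor23Hyp) :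
    Literature.IUT.HodgeTheaters.StableCurveTemperedData.Cor23iii D ↔
      IsSlimGroup D.deltaHatH ∧
        ∀ g : D.PiTp, ∃ d : D.DeltaTp, MulAut.conj g • (D.deltaTpH.map D.DeltaTp.subtype) =
          MulAut.conj (d : D.PiTp) • (D.deltaTpH.map D.DeltaTp.subtype) :=
  ⟨fun h => ⟨h.slim hyp, D.surjective_piTpXH_iff.mp (h.exact_tp hyp).2⟩,
    fun h => D.cor23iii_of_slim_of_surjective hi hii (fun _ => h.1) hGk
      (D.surjective_piTpXH_iff.mpr h.2)⟩

end StableCurveTemperedData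

end Literature.IUT.HodgeTheaters
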